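import Summits.MatrixMultiplication.MatrixMultiplication.Theses.FourierTwoFamiliesModP

/-!
# The translate class: `n s² ≤ p`, attained at every `s`

Crux `FourierTwoFamiliesModP.PrimeDensityDecay` (stmt-MatrixMultiplication-14311), refuter / crux-disprover lane
(`Theorems/PrimeDensityDecay/Negative/`).  `translate_family_bound` (`A_i = t_i + A`, `B_i = t_i + B` ⇒ `n s² ≤ p`), `primeDensityDecay_of_translates` (the crux on that class with `s₀ = ⌈1/ε⌉ + 1`) and `translate_bound_tight` (the family `i s² + [0,s)`, `i s² + s[0,s)` is balanced SDPP with `n = ⌊p/s²⌋` for every `s ≥ 1`, `p ≥ s²`).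
These are the landed copies of the sections of the standing disproof work file
`Cruxes/PrimeDensityDecay/Disproof.lean` (same statements and proofs, namespace `…Negative.Disproof`); no theorem here
asserts a Theses decl positively.
-/

namespace Summit.MatrixMultiplication.MatrixMultiplication.Theorems.PrimeDensityDecay.Negative.Disproof

open Finset
open Summit.MatrixMultiplication.MatrixMultiplication.Theses.FourierTwoFamiliesModP

/-! ## (b') Tightness: translates attain `n = ⌊p/s²⌋` at EVERY `s` (so `s₀(ε) > 1/ε − 1`) -/

/-- Translate blocks `A_i = i·s² + {0,…,s-1}` cast into `ZMod p`. -/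
def trA (p s i : ℕ) : Finset (ZMod p) :=
  (Finset.range s).image (fun j : ℕ => ((i * (s * s) + j : ℕ) : ZMod p))

/-- Translate blocks `B_i = i·s² + {0, s, …, (s-1)s}` cast into `ZMod p`. -/
def trB (p s i : ℕ) : Finset (ZMod p) :=
  (Finset.range s).image (fun j : ℕ => ((i * (s * s) + s * j : ℕ) : ZMod p))

/-- `|(j₁ − j₂) + s(j₃ − j₄)| < s²` for digits `< s`. -/
lemma digits_abs_lt {s j₁ j₂ j₃ j₄ : ℕ} (h₁ : j₁ < s) (h₂ : j₂ < s) (h₃ : j₃ < s) (h₄ : j₄ < s) :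
    |((j₁ : ℤ) - j₂) + s * ((j₃ : ℤ) - j₄)| < (s : ℤ) * s := by
  have a3 : s * j₃ + s ≤ s * s := by
    have := Nat.mul_le_mul_left s h₃; rw [Nat.mul_succ] at this; exact this
  have a4 : s * j₄ + s ≤ s * s := by
    have := Nat.mul_le_mul_left s h₄; rw [Nat.mul_succ] at this; exact this
  have a3' : (s : ℤ) * j₃ + s ≤ (s : ℤ) * s := by exact_mod_cast a3
  have a4' : (s : ℤ) * j₄ + s ≤ (s : ℤ) * s := by exact_mod_cast a4
  have h₁' : (j₁ : ℤ) < s := by exact_mod_cast h₁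
  have h₂' : (j₂ : ℤ) < s := by exact_mod_cast h₂
  have n1 : (0 : ℤ) ≤ j₁ := Nat.cast_nonneg j₁
  have n2 : (0 : ℤ) ≤ j₂ := Nat.cast_nonneg j₂
  have n3 : (0 : ℤ) ≤ (s : ℤ) * j₃ := by positivity
  have n4 : (0 : ℤ) ≤ (s : ℤ) * j₄ := by positivity
  rw [abs_lt]
  constructor <;> nlinarith

/-- Balanced base-`s` digits: `(j₁ − j₂) + s(j₃ − j₄) = 0` with all digits `< s` forces equality. -/
lemma digits_eq {s j₁ j₂ j₃ j₄ : ℕ} (h₁ : j₁ < s) (h₂ : j₂ < s)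
    (h : ((j₁ : ℤ) - j₂) + s * ((j₃ : ℤ) - j₄) = 0) : j₁ = j₂ ∧ j₃ = j₄ := by
  have h' : j₁ + s * j₃ = j₂ + s * j₄ := by
    have : ((j₁ + s * j₃ : ℕ) : ℤ) = ((j₂ + s * j₄ : ℕ) : ℤ) := by push_cast; linarith
    exact_mod_cast this
  have hmod := congrArg (· % s) h'
  simp only [Nat.add_mul_mod_self_left, Nat.mod_eq_of_lt h₁, Nat.mod_eq_of_lt h₂] at hmod
  subst hmod
  exact ⟨rfl, Nat.eq_of_mul_eq_mul_left (Nat.zero_lt_of_lt h₁) (by omega)⟩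

/-- `|trA p s i| = s` when `s ≤ p`. -/
lemma card_trA {p s : ℕ} (hsp : s ≤ p) (i : ℕ) : (trA p s i).card = s := by
  classical
  rw [trA, Finset.card_image_of_injOn, Finset.card_range]
  intro j₁ hj₁ j₂ hj₂ h
  simp only [Finset.coe_range, Set.mem_Iio] at hj₁ hj₂
  have hz : ((((j₁ : ℤ) - j₂) : ℤ) : ZMod p) = 0 := by
    have h' : ((i * (s * s) + j₁ : ℕ) : ZMod p) = ((i * (s * s) + j₂ : ℕ) : ZMod p) := h
    push_cast at h' ⊢
    linear_combination h'
  rw [ZMod.intCast_zmod_eq_zero_iff_dvd] at hz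
  have hlt : |((j₁ : ℤ) - j₂)| < (p : ℤ) := by
    have h₁' : (j₁ : ℤ) < s := by exact_mod_cast hj₁
    have h₂' : (j₂ : ℤ) < s := by exact_mod_cast hj₂
    have hsp' : (s : ℤ) ≤ p := by exact_mod_cast hsp
    have n1 : (0 : ℤ) ≤ j₁ := Nat.cast_nonneg j₁
    have n2 : (0 : ℤ) ≤ j₂ := Nat.cast_nonneg j₂
    rw [abs_lt]; constructor <;> linarith
  have h0 := Int.eq_zero_of_abs_lt_dvd hz hlt
  omega

/-- `|trB p s i| = s` when `s*s ≤ p`. -/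
lemma card_trB {p s : ℕ} (hsp : s * s ≤ p) (i : ℕ) : (trB p s i).card = s := by
  classical
  rw [trB, Finset.card_image_of_injOn, Finset.card_range]
  intro j₁ hj₁ j₂ hj₂ h
  simp only [Finset.coe_range, Set.mem_Iio] at hj₁ hj₂
  have hz : (((s * ((j₁ : ℤ) - j₂)) : ℤ) : ZMod p) = 0 := by
    have h' : ((i * (s * s) + s * j₁ : ℕ) : ZMod p) = ((i * (s * s) + s * j₂ : ℕ) : ZMod p) := h
    push_cast at h' ⊢
    linear_combination h'
  rw [ZMod.intCast_zmod_eq_zero_iff_dvd] at hz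
  have hlt : |(s * ((j₁ : ℤ) - j₂))| < (p : ℤ) := by
    have := digits_abs_lt hj₁ hj₁ hj₁ hj₂
    have hsp' : (s : ℤ) * s ≤ p := by exact_mod_cast hsp
    simp only [sub_self, zero_add] at this
    exact lt_of_lt_of_le this hsp'
  have h0 := Int.eq_zero_of_abs_lt_dvd hz hlt
  have hs : (s : ℤ) ≠ 0 := by exact_mod_cast (Nat.ne_of_gt (Nat.zero_lt_of_lt hj₁))
  have := (mul_eq_zero.mp h0).resolve_left hs
  omega

/-- (W) for every translate block (only `s*s ≤ p` is needed: four-term relations are integers of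
absolute value `< s² ≤ p`). -/
lemma tr_W {p s : ℕ} (hsp : s * s ≤ p) (i : ℕ) :
    ∀ a ∈ trA p s i, ∀ a' ∈ trA p s i, ∀ b ∈ trB p s i, ∀ b' ∈ trB p s i,
      (a - a') + (b - b') = 0 → a = a' ∧ b = b' := by
  intro a ha a' ha' b hb b' hb' h
  simp only [trA, trB, Finset.mem_image, Finset.mem_range] at ha ha' hb hb'
  obtain ⟨j₁, hj₁, rfl⟩ := ha
  obtain ⟨j₂, hj₂, rfl⟩ := ha'
  obtain ⟨j₃, hj₃, rfl⟩ := hb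
  obtain ⟨j₄, hj₄, rfl⟩ := hb'
  have hz : (((((j₁ : ℤ) - j₂) + s * ((j₃ : ℤ) - j₄)) : ℤ) : ZMod p) = 0 := by
    push_cast at h ⊢
    linear_combination h
  rw [ZMod.intCast_zmod_eq_zero_iff_dvd] at hz
  have hsp' : (s : ℤ) * s ≤ p := by exact_mod_cast hsp
  have h0 := Int.eq_zero_of_abs_lt_dvd hz (lt_of_lt_of_le (digits_abs_lt hj₁ hj₂ hj₃ hj₄) hsp')
  obtain ⟨rfl, rfl⟩ := digits_eq hj₁ hj₂ h0
  exact ⟨rfl, rfl⟩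

/-- (X) for the translate family with `n·s² ≤ p`: a four-term relation is the integer
`(i − k)s² + r`, `|r| < s²`, `|i − k| < n`, of absolute value `< n s² ≤ p`, hence `0`, hence
`i = k`. -/
lemma tr_X {p s n : ℕ} (hn : n * (s * s) ≤ p) :
    ∀ i j k : Fin n, ∀ a ∈ trA p s i, ∀ a' ∈ trA p s j, ∀ b ∈ trB p s j, ∀ b' ∈ trB p s k,
      (a - a') + (b - b') = 0 → i = k := by
  intro i j k a ha a' ha' b hb b' hb' h
  simp only [trA, trB, Finset.mem_image, Finset.mem_range] at ha ha' hb hb'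
  obtain ⟨j₁, hj₁, rfl⟩ := ha
  obtain ⟨j₂, hj₂, rfl⟩ := ha'
  obtain ⟨j₃, hj₃, rfl⟩ := hb
  obtain ⟨j₄, hj₄, rfl⟩ := hb'
  set r : ℤ := ((j₁ : ℤ) - j₂) + s * ((j₃ : ℤ) - j₄) with hr
  have hz : ((((((i : ℕ) : ℤ) - ((k : ℕ) : ℤ)) * ((s : ℤ) * s) + r) : ℤ) : ZMod p) = 0 := by
    rw [hr]
    push_cast at h ⊢
    linear_combination h
  rw [ZMod.intCast_zmod_eq_zero_iff_dvd] at hz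
  have hrabs := abs_lt.mp (digits_abs_lt hj₁ hj₂ hj₃ hj₄)
  rw [← hr] at hrabs
  have hi : (((i : ℕ) : ℤ)) < n := by exact_mod_cast i.isLt
  have hk : (((k : ℕ) : ℤ)) < n := by exact_mod_cast k.isLt
  have hi0 : (0 : ℤ) ≤ ((i : ℕ) : ℤ) := Nat.cast_nonneg _
  have hk0 : (0 : ℤ) ≤ ((k : ℕ) : ℤ) := Nat.cast_nonneg _
  have hss : (0 : ℤ) ≤ (s : ℤ) * s := by positivity
  have hn' : (n : ℤ) * ((s : ℤ) * s) ≤ p := by exact_mod_cast hn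
  have up1 : (((i : ℕ) : ℤ) - ((k : ℕ) : ℤ)) * ((s : ℤ) * s) ≤ ((n : ℤ) - 1) * ((s : ℤ) * s) :=
    mul_le_mul_of_nonneg_right (by linarith) hss
  have lo1 : (1 - (n : ℤ)) * ((s : ℤ) * s) ≤ (((i : ℕ) : ℤ) - ((k : ℕ) : ℤ)) * ((s : ℤ) * s) :=
    mul_le_mul_of_nonneg_right (by linarith) hss
  have habs : |(((i : ℕ) : ℤ) - ((k : ℕ) : ℤ)) * ((s : ℤ) * s) + r| < (p : ℤ) := by
    rw [abs_lt]; constructor <;> nlinarith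
  have h0 := Int.eq_zero_of_abs_lt_dvd hz habs
  -- now (i - k) s² = -r with |r| < s²
  by_contra hik
  have hik' : ((i : ℕ) : ℤ) ≠ ((k : ℕ) : ℤ) := by
    intro e; exact hik (Fin.ext (by exact_mod_cast e))
  rcases lt_or_gt_of_ne hik' with hlt | hgt
  · have : (((i : ℕ) : ℤ) - ((k : ℕ) : ℤ)) * ((s : ℤ) * s) ≤ (-1) * ((s : ℤ) * s) :=
      mul_le_mul_of_nonneg_right (by linarith) hss
    nlinarith
  · have : (1 : ℤ) * ((s : ℤ) * s) ≤ (((i : ℕ) : ℤ) - ((k : ℕ) : ℤ)) * ((s : ℤ) * s) :=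
      mul_le_mul_of_nonneg_right (by linarith) hss
    nlinarith

/-- TIGHTNESS OF THE TRANSLATE BOUND, at every block size: for all `s ≥ 1` and every modulus
`p ≥ s²` the translate family has `n = ⌊p/s²⌋` blocks, i.e. `p < (n+1)s²`, so `n s > p/s − s`.
Consequently the crux's threshold must satisfy `s₀(ε) ≥ 1/ε − O(1)` (take `p ≥ s³`): the
density `1/s` is attained at EVERY `s`, and `translate_family_bound` is sharp. -/
theorem translate_bound_tight {p s : ℕ} (hs : 1 ≤ s) (hsp : s * s ≤ p) :
    ∃ (n : ℕ) (A B : Fin n → Finset (ZMod p)),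
      p < (n + 1) * (s * s) ∧
      (∀ i : Fin n, (A i).card = s ∧ (B i).card = s) ∧
      (∀ i : Fin n, ∀ a ∈ A i, ∀ a' ∈ A i, ∀ b ∈ B i, ∀ b' ∈ B i,
        (a - a') + (b - b') = 0 → a = a' ∧ b = b') ∧
      (∀ i j k : Fin n, ∀ a ∈ A i, ∀ a' ∈ A j, ∀ b ∈ B j, ∀ b' ∈ B k,
        (a - a') + (b - b') = 0 → i = k) := by
  have hss : 0 < s * s := Nat.mul_pos hs hs
  refine ⟨p / (s * s), fun i => trA p s i, fun i => trB p s i, ?_, ?_, ?_, ?_⟩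
  · have := Nat.lt_div_mul_add (a := p) hss
    linarith [this]
  · intro i
    exact ⟨card_trA (le_trans (Nat.le_mul_self s) hsp) i, card_trB hsp i⟩
  · intro i
    exact tr_W hsp i
  · exact tr_X (Nat.div_mul_le_self p (s * s))

/-! ## (c) Why it resists: the translate class is provably capped at density `1/s` -/

/-- TRANSLATE FAMILIES OBEY THE CRUX WITH ROOM TO SPARE.  If `A_i = t_i + A`, `B_i = t_i + B`
(`|A| = |B| = s`, (W) for the pair, (X) for the family) then `n·s² ≤ p`: the `n` translates
`t_i + (A + B)` have `s²` elements each by (W) and are pairwise disjoint by (X) (a common element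
`t_i + a₁ + b₁ = t_k + a₂ + b₂` gives the forbidden relation
`(t_i + a₁) − (t_k + a₂) + (t_k + b₁) − (t_k + b₂) = 0` with pattern `(i, k, k, k)`).
So density `ns/p ≤ 1/s`, the crux holds on this class with `s₀ = ⌈1/ε⌉ + 1`, and — since the exact
`s = 2` census is attained by translates — a refutation needs a genuinely different design paradigm. -/
theorem translate_family_bound {p : ℕ} [NeZero p] {n s : ℕ} (A B : Finset (ZMod p))
    (t : Fin n → ZMod p) (hA : A.card = s) (hB : B.card = s)
    (hW : ∀ a ∈ A, ∀ a' ∈ A, ∀ b ∈ B, ∀ b' ∈ B, (a - a') + (b - b') = 0 → a = a' ∧ b = b')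
    (hX : ∀ i j k : Fin n, ∀ a ∈ A.image (t i + ·), ∀ a' ∈ A.image (t j + ·), ∀ b ∈ B.image (t j + ·),
      ∀ b' ∈ B.image (t k + ·), (a - a') + (b - b') = 0 → i = k) :
    n * s ^ 2 ≤ p := by
  classical
  set AB : Finset (ZMod p) := (A ×ˢ B).image (fun ab : ZMod p × ZMod p => ab.1 + ab.2) with hABdef
  have hAB : AB.card = s ^ 2 := by
    rw [hABdef, Finset.card_image_of_injOn, Finset.card_product, hA, hB, sq]
    rintro ⟨a, b⟩ hab ⟨a', b'⟩ hab' h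
    simp only [Finset.coe_product, Set.mem_prod, Finset.mem_coe] at hab hab'
    have h' : a + b = a' + b' := h
    obtain ⟨rfl, rfl⟩ := hW a hab.1 a' hab'.1 b hab.2 b' hab'.2 (by linear_combination h')
    rfl
  set S : Fin n → Finset (ZMod p) := fun i => AB.image (t i + ·) with hSdef
  have hS : ∀ i, (S i).card = s ^ 2 := fun i => by
    rw [hSdef, Finset.card_image_of_injective _ (add_right_injective (t i)), hAB]
  have hdisj : Set.PairwiseDisjoint (↑(Finset.univ : Finset (Fin n))) S := by
    intro i _ k _ hik
    rw [Function.onFun, Finset.disjoint_left]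
    intro z hzi hzk
    simp only [hSdef, hABdef, Finset.mem_image, Finset.mem_product, Prod.exists] at hzi hzk
    obtain ⟨_, ⟨a₁, b₁, ⟨ha₁, hb₁⟩, rfl⟩, rfl⟩ := hzi
    obtain ⟨_, ⟨a₂, b₂, ⟨ha₂, hb₂⟩, rfl⟩, hk⟩ := hzk
    apply hik
    refine hX i k k (t i + a₁) ?_ (t k + a₂) ?_ (t k + b₁) ?_ (t k + b₂) ?_ ?_
    · exact Finset.mem_image.mpr ⟨a₁, ha₁, rfl⟩
    · exact Finset.mem_image.mpr ⟨a₂, ha₂, rfl⟩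
    · exact Finset.mem_image.mpr ⟨b₁, hb₁, rfl⟩
    · exact Finset.mem_image.mpr ⟨b₂, hb₂, rfl⟩
    · linear_combination (-1 : ZMod p) * hk
  have hcard := Finset.card_biUnion hdisj
  have hle : (Finset.univ.biUnion S).card ≤ Fintype.card (ZMod p) := Finset.card_le_univ _
  rw [ZMod.card] at hle
  calc n * s ^ 2 = ∑ _i : Fin n, s ^ 2 := by simp
    _ = ∑ i : Fin n, (S i).card := by simp [hS]
    _ = (Finset.univ.biUnion S).card := hcard.symm
    _ ≤ p := hle

/-- Corollary: the crux restricted to translate families, with the explicit threshold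
`s₀ = ⌈1/ε⌉₊ + 1`. -/
theorem primeDensityDecay_of_translates (ε : ℝ) (hε : 0 < ε) :
    ∃ s₀ : ℕ, ∀ p : ℕ, p.Prime → ∀ (n s : ℕ) (A B : Finset (ZMod p)) (t : Fin n → ZMod p), s₀ ≤ s →
      A.card = s → B.card = s →
      (∀ a ∈ A, ∀ a' ∈ A, ∀ b ∈ B, ∀ b' ∈ B, (a - a') + (b - b') = 0 → a = a' ∧ b = b') →
      (∀ i j k : Fin n, ∀ a ∈ A.image (t i + ·), ∀ a' ∈ A.image (t j + ·), ∀ b ∈ B.image (t j + ·),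
        ∀ b' ∈ B.image (t k + ·), (a - a') + (b - b') = 0 → i = k) →
      (n : ℝ) * (s : ℝ) ≤ ε * (p : ℝ) := by
  refine ⟨⌈1 / ε⌉₊ + 1, ?_⟩
  intro p hp n s A B t hs hA hB hW hX
  haveI : NeZero p := ⟨hp.ne_zero⟩
  have hb := translate_family_bound A B t hA hB hW hX
  have hb' : (n : ℝ) * (s : ℝ) ^ 2 ≤ (p : ℝ) := by exact_mod_cast hb
  have hs1 : (1 / ε : ℝ) < s := by
    have h1 : (⌈1 / ε⌉₊ : ℝ) < ((⌈1 / ε⌉₊ + 1 : ℕ) : ℝ) := by push_cast; linarith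
    have h2 : (((⌈1 / ε⌉₊ + 1 : ℕ) : ℝ)) ≤ s := by exact_mod_cast hs
    exact lt_of_le_of_lt (Nat.le_ceil _) (lt_of_lt_of_le h1 h2)
  have hspos : (0 : ℝ) < s := lt_trans (by positivity) hs1
  have hεs : 1 < ε * s := by
    have := (div_lt_iff₀ hε).mp hs1
    linarith [this]
  have hn : (0 : ℝ) ≤ n := Nat.cast_nonneg n
  calc (n : ℝ) * s ≤ (n : ℝ) * s * (ε * s) := by
        have : 0 ≤ (n : ℝ) * s := mul_nonneg hn hspos.le
        nlinarith
    _ = ε * ((n : ℝ) * (s : ℝ) ^ 2) := by ring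
    _ ≤ ε * p := by exact mul_le_mul_of_nonneg_left hb' hε.le



end Summit.MatrixMultiplication.MatrixMultiplication.Theorems.PrimeDensityDecay.Negative.Disproof
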